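import Summits.QuantumAdvantage.AdviceFreeQNC0.OutHeavyStar
import Summits.QuantumAdvantage.AdviceFreeQNC0.MassInequalityRegimesProofs
import HarnessLib

/-!
# Cell qa-qnc0 (rung F-Q1, density axis): LEMMA G′ (repaired) — `SC1At m K0 → OutHeavyButOne m K0 c → StarCert m K0`,
# and ONE-WORD MI at m = 8 from the single finite fact `OutHeavyEight` (planner qa-qnc0-p1 gen 14, ask P19)

Continuation of `OutHeavyStar.lean` (core lemmas).  Here: the case analysis producing the fractional inside
word in the frame where `0` is the mismatch minimiser (`OutHeavyMain.starCore`: `q ≡ 1/2` when `2e ≥ w`;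
else the two-level word with `α = max(0, L₁, L₂)`, `β = (e − t₁α)/(w − t₁)`, degenerate sub-cases
`t₁ = 0` / `t₁ = w`), the translation by a minimising codeword `A` (`s ↦ s ⊕ A`, `q ↦` reflected on
`supp A`, `X ↦ X ⊕ A`), and the assembly:

* **`starCert_of_outHeavyButOne : SC1At m K0 → OutHeavyButOne m K0 c → StarCert m K0`** (Lemma G′ with
  the support-concentration hypothesis its proof needs — see the FINDING in `OutHeavyStar.lean`);
* **`oneWordMIEight_of_outHeavyEight : OutHeavyEight → OneWordMIEight`** (with `relMIOfStar`,
  `oneWordOfRelMI` [qn-prover g8], `oneWordDecode` [qn-lit], `sc1At_of_isOpt1` [qn-lit]): ONE-WORD MI at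
  `m = 8` hangs on the single finite fact `OutHeavyEight`.

WHAT THIS IS NOT: `OutHeavyEight` is not proved here; the literal `StarOfOutHeavyButOne 8` is NOT proved
(likely false); separation NOT moved.
-/

noncomputable section

namespace Summit.QuantumAdvantage.AdviceFreeQNC0

open Finset
open MassInequality ColTestProofs OutHeavyCore

namespace OutHeavyMain

variable {m : ℕ} {K0 c s : (Fin m → Bool) → Bool}

/-- The column test for a two-level inside word, given the four inequalities of ROUND-13 §1. -/
theorem core_test (hOH : OutHeavyButOne m K0 c) {α β : ℚ}
    (hα0 : 0 ≤ α) (hα : 2 * α ≤ 1) (hβ0 : 0 ≤ β) (hβ : 2 * β ≤ 1)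
    (heq : (tIn K0 c : ℚ) * α + ((failCount K0 : ℚ) - tIn K0 c) * β = eOut K0 s)
    (hL1 : (tIn K0 c : ℚ) + 2 * iOut K0 c s ≤ 2 * (tIn K0 c) * α + MassInequality.outCount K0 c)
    (Y : (Fin m → Bool) → Bool) (hY : IsElim1 m Y) :
    (∑ z ∈ univ.filter (fun z : Fin m → Bool => K0 z = false), |bq (Y z) - (if c z = true then α else β)|) ≤
      (mis K0 s Y : ℚ) := by
  rw [sum_two_level Y hα0 (by linarith) hβ0 (by linarith)]
  set a₁ := ((univ.filter fun z : Fin m → Bool => K0 z = false ∧ (c z = true ∧ Y z = true)).card : ℚ) with ha₁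
  set a₂ := ((univ.filter fun z : Fin m → Bool => K0 z = false ∧ (c z = false ∧ Y z = true)).card : ℚ) with ha₂
  by_cases hY0 : Y = fun _ => false
  · subst hY0
    have h1 : a₁ = 0 := by rw [ha₁]; simp
    have h2 : a₂ = 0 := by rw [ha₂]; simp
    rw [h1, h2, mis_zero]; linarith
  by_cases hYc : Y = c
  · subst hYc
    have h1 : a₁ = tIn K0 Y := by
      rw [ha₁]; unfold tIn; congr 2; ext z; simp
    have h2 : a₂ = 0 := by
      rw [ha₂]; norm_cast; rw [Finset.card_eq_zero, filter_eq_empty_iff]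
      intro z _ h; rw [h.2.1] at h; exact Bool.false_ne_true h.2.2
    have h3 : ((mis K0 s Y : ℕ) : ℚ) + 2 * iOut K0 Y s = MassInequality.outCount K0 Y + eOut K0 s := by exact_mod_cast mis_c_add
    rw [h1, h2]; nlinarith
  -- the generic case: `Y ∉ {0, c}`
  have hpwt : pwt Y ≠ 0 := by
    intro h; apply hY0; funext v
    unfold pwt at h; rw [Finset.card_eq_zero, filter_eq_empty_iff] at h
    have := h (mem_univ v); cases hv : Y v
    · rfl
    · exact absurd hv this
  have hw : (failCount K0 : ℚ) ≤ mis K0 s Y + eOut K0 s := by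
    have h1 := hOH.2 Y hY hpwt hYc
    have h2 := outCount_le_mis_add (K0 := K0) (s := s) Y
    exact_mod_cast h1.trans h2
  have ha₁t : a₁ ≤ tIn K0 c := by
    rw [ha₁]; unfold tIn
    exact_mod_cast card_le_card fun z hz => by
      simp only [mem_filter, mem_univ, true_and] at hz ⊢; exact ⟨hz.1, hz.2.1⟩
  have ha₂t : a₂ + tIn K0 c ≤ failCount K0 := by
    rw [ha₂]; unfold tIn failCount
    have h : (univ.filter fun z : Fin m → Bool => K0 z = false ∧ (c z = false ∧ Y z = true)).card +
        (univ.filter fun u : Fin m → Bool => K0 u = false ∧ c u = true).card ≤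
        (univ.filter fun u : Fin m → Bool => K0 u = false).card := by
      rw [← card_union_of_disjoint (disjoint_filter.2 fun u _ h1 h2 => by
        rw [h1.2.1] at h2; exact Bool.false_ne_true h2.2)]
      exact card_le_card fun u hu => by
        simp only [mem_union, mem_filter, mem_univ, true_and] at hu ⊢
        rcases hu with h | h
        · exact h.1
        · exact h.1
    exact_mod_cast h
  have e1 : (1 - 2 * α) * a₁ ≤ (1 - 2 * α) * tIn K0 c := mul_le_mul_of_nonneg_left ha₁t (by linarith)
  have e2 : (1 - 2 * β) * a₂ ≤ (1 - 2 * β) * ((failCount K0 : ℚ) - tIn K0 c) :=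
    mul_le_mul_of_nonneg_left (by linarith) (by linarith)
  nlinarith

/-- `2 i ≤ t₂` and `i ≤ e`, `t₁ ≤ w` in rational form. -/
theorem basic_ineqs (hmin0 : ∀ Y, IsElim1 m Y → eOut K0 s ≤ mis K0 s Y) (hc : IsElim1 m c) :
    2 * (iOut K0 c s : ℚ) ≤ MassInequality.outCount K0 c ∧ (iOut K0 c s : ℚ) ≤ eOut K0 s ∧ (tIn K0 c : ℚ) ≤ failCount K0 := by
  have h1 := hmin0 c hc
  have h2 := mis_c_add (K0 := K0) (c := c) (s := s)
  have h3 := iOut_le_eOut (K0 := K0) (c := c) (s := s)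
  have h4 := tIn_le_failCount (K0 := K0) (c := c)
  refine ⟨?_, by exact_mod_cast h3, by exact_mod_cast h4⟩
  have : 2 * iOut K0 c s ≤ MassInequality.outCount K0 c := by omega
  exact_mod_cast this

/-- **The core in the zero-minimiser frame**: a fractional inside word passing the column test against `s`. -/
theorem starCore (hK : SC1At m K0) (hOH : OutHeavyButOne m K0 c)
    (hmin0 : ∀ Y, IsElim1 m Y → eOut K0 s ≤ mis K0 s Y) : ∃ q, ColTest m K0 q s := by
  obtain ⟨h2i, hie, htw⟩ := basic_ineqs hmin0 hOH.1
  have ht12 : (tIn K0 c : ℚ) ≤ MassInequality.outCount K0 c := by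
    have h : MassInequality.inCount K0 c ≤ MassInequality.outCount K0 c := hK c hOH.1
    rw [← tIn_eq_inCount] at h
    exact_mod_cast h
  set w : ℚ := (failCount K0 : ℚ) with hw
  set e : ℚ := (eOut K0 s : ℚ) with he
  set t₁ : ℚ := (tIn K0 c : ℚ) with ht₁
  set t₂ : ℚ := (MassInequality.outCount K0 c : ℚ) with ht₂
  set i : ℚ := (iOut K0 c s : ℚ) with hi
  have he0 : 0 ≤ e := by rw [he]; exact Nat.cast_nonneg _
  have ht0 : 0 ≤ t₁ := by rw [ht₁]; exact Nat.cast_nonneg _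
  have hi0 : 0 ≤ i := by rw [hi]; exact Nat.cast_nonneg _
  -- the test RHS is `mis`
  have hmis : ∀ X, ((univ.filter fun u : Fin m → Bool => K0 u = true ∧ X u ≠ s u).card : ℚ) = mis K0 s X :=
    fun X => rfl
  by_cases hA : w ≤ 2 * e
  · -- case `2e ≥ w`: `q ≡ 1/2`
    refine ⟨fun _ => 1 / 2, fun z _ => by norm_num, fun X hX => ?_⟩
    have hsum : (∑ z ∈ univ.filter (fun z : Fin m → Bool => K0 z = false), |bq (X z) - 1 / 2|) = w / 2 := by
      rw [Finset.sum_congr rfl fun z _ => show |bq (X z) - 1 / 2| = (1 / 2 : ℚ) by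
        cases X z <;> norm_num [bq], sum_const, nsmul_eq_mul, hw]
      unfold failCount; ring
    rw [hsum, hmis]
    have := hmin0 X hX
    have h' : e ≤ mis K0 s X := by rw [he]; exact_mod_cast this
    linarith
  rw [not_le] at hA
  -- case `2e < w`: the two-level word
  have hwpos : 0 < w := by linarith
  -- choose (α, β)
  obtain ⟨α, β, hα0, hα, hβ0, hβ, heq, hL1⟩ : ∃ α β : ℚ, 0 ≤ α ∧ 2 * α ≤ 1 ∧ 0 ≤ β ∧ 2 * β ≤ 1 ∧
      t₁ * α + (w - t₁) * β = e ∧ t₁ + 2 * i ≤ 2 * t₁ * α + t₂ := by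
    have hew : e / w * w = e := div_mul_cancel₀ e (ne_of_gt hwpos)
    by_cases ht1z : t₁ = 0
    · refine ⟨0, e / w, le_rfl, by norm_num, div_nonneg he0 hwpos.le, ?_, ?_, ?_⟩
      · rw [mul_div_assoc', div_le_one hwpos]; linarith
      · rw [ht1z, sub_zero, zero_mul, zero_add, mul_comm]; exact hew
      · rw [ht1z]; linarith
    have ht1pos : 0 < t₁ := lt_of_le_of_ne ht0 (Ne.symm ht1z)
    by_cases ht1w : t₁ = w
    · refine ⟨e / w, 0, div_nonneg he0 hwpos.le, ?_, le_rfl, by norm_num, ?_, ?_⟩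
      · rw [mul_div_assoc', div_le_one hwpos]; linarith
      · rw [ht1w, sub_self, zero_mul, add_zero, mul_comm]; exact hew
      · have h2 : 2 * w * (e / w) = 2 * e := by rw [mul_assoc, mul_comm w, hew]
        rw [ht1w, h2]; linarith
    have hwt : 0 < w - t₁ := by
      rcases lt_or_eq_of_le htw with h | h
      · linarith
      · exact absurd h ht1w
    set L₁ : ℚ := (t₁ + 2 * i - t₂) / (2 * t₁) with hL₁
    set L₂ : ℚ := (2 * e + t₁ - w) / (2 * t₁) with hL₂
    set α : ℚ := max 0 (max L₁ L₂) with hαdef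
    have hαL₁ : L₁ ≤ α := (le_max_left _ _).trans (le_max_right _ _)
    have hαL₂ : L₂ ≤ α := (le_max_right _ _).trans (le_max_right _ _)
    have hα0 : 0 ≤ α := le_max_left _ _
    have h2t : 0 < 2 * t₁ := by linarith
    -- upper bounds on α
    have hL₁half : L₁ ≤ 1 / 2 := by rw [hL₁, div_le_iff₀ h2t]; linarith
    have hL₂half : L₂ ≤ 1 / 2 := by rw [hL₂, div_le_iff₀ h2t]; linarith
    have hL₁e : L₁ ≤ e / t₁ := by rw [hL₁, div_le_div_iff₀ h2t ht1pos]; nlinarith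
    have hL₂e : L₂ ≤ e / t₁ := by rw [hL₂, div_le_div_iff₀ h2t ht1pos]; nlinarith
    have hαhalf : α ≤ 1 / 2 := max_le (by norm_num) (max_le hL₁half hL₂half)
    have hαe : α ≤ e / t₁ := max_le (div_nonneg he0 ht0) (max_le hL₁e hL₂e)
    have hαe' : t₁ * α ≤ e := by rwa [le_div_iff₀ ht1pos, mul_comm] at hαe
    refine ⟨α, (e - t₁ * α) / (w - t₁), hα0, by linarith, div_nonneg (by linarith) hwt.le, ?_, ?_, ?_⟩
    · -- 2β ≤ 1 from α ≥ L₂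
      rw [mul_div_assoc', div_le_one hwt]
      have : 2 * e + t₁ - w ≤ 2 * t₁ * α := by
        have h := hαL₂; rw [hL₂, div_le_iff₀ h2t] at h; linarith
      linarith
    · rw [mul_comm (w - t₁) _, div_mul_cancel₀ _ (ne_of_gt hwt)]; ring
    · have h := hαL₁; rw [hL₁, div_le_iff₀ h2t] at h; linarith
  refine ⟨fun z => if c z = true then α else β, fun z _ => ?_, fun X hX => ?_⟩
  · dsimp only
    by_cases hcz : c z = true
    · rw [if_pos hcz]; exact ⟨hα0, by linarith⟩
    · rw [if_neg hcz]; exact ⟨hβ0, by linarith⟩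
  · rw [hmis]
    exact core_test hOH hα0 hα hβ0 hβ (by rw [← ht₁, ← hw, ← he]; exact heq)
      (by rw [← ht₁, ← hi, ← ht₂]; linarith) X hX

end OutHeavyMain

open OutHeavyMain

/-- **LEMMA G′ (repaired)**: support concentration at `K0` and outside-heaviness with one named exception
give (★) at `K0`. -/
theorem starCert_of_outHeavyButOne {m : ℕ} {K0 c : (Fin m → Bool) → Bool} (hK : SC1At m K0)
    (hOH : OutHeavyButOne m K0 c) : StarCert m K0 := by
  classical
  intro s
  -- a codeword minimising the outside mismatch with `s`
  obtain ⟨A, hA, hAmin⟩ : ∃ A, IsElim1 m A ∧ ∀ Y, IsElim1 m Y → mis K0 s A ≤ mis K0 s Y := by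
    obtain ⟨A, hA, h⟩ := exists_min_image (univ.filter fun A : (Fin m → Bool) → Bool => IsElim1 m A)
      (mis K0 s) ⟨fun _ => false, by simp [isElim1_false]⟩
    exact ⟨A, (mem_filter.1 hA).2, fun Y hY => h Y (by simp [hY])⟩
  -- translate by `A`
  set s' : (Fin m → Bool) → Bool := fun u => xor (s u) (A u) with hs'
  have hmis' : ∀ Y, mis K0 s' Y = mis K0 s (fun u => xor (Y u) (A u)) := by
    intro Y; unfold mis; congr 1; ext u
    simp only [mem_filter, mem_univ, true_and, hs']
    cases Y u <;> cases A u <;> cases s u <;> simp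
  have hmin0 : ∀ Y, IsElim1 m Y → eOut K0 s' ≤ mis K0 s' Y := by
    intro Y hY
    rw [← mis_zero, hmis', hmis']
    have e0 : (fun u => xor ((fun _ : Fin m → Bool => false) u) (A u)) = A := funext fun u => by simp
    rw [e0]
    exact hAmin _ (isElim1_xor hY hA)
  obtain ⟨q', hq'01, hq'test⟩ := starCore (s := s') hK hOH hmin0
  refine ⟨fun z => if A z = true then 1 - q' z else q' z, fun z hz => ?_, fun X hX => ?_⟩
  · obtain ⟨h0, h1⟩ := hq'01 z hz
    dsimp only
    by_cases hAz : A z = true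
    · rw [if_pos hAz]; exact ⟨by linarith, by linarith⟩
    · rw [if_neg hAz]; exact ⟨h0, h1⟩
  · have h := hq'test (fun u => xor (X u) (A u)) (isElim1_xor hX hA)
    have hl : ∀ z, |bq (X z) - (if A z = true then 1 - q' z else q' z)| = |bq (xor (X z) (A z)) - q' z| := by
      intro z
      cases X z <;> cases A z <;> simp only [bq, Bool.xor_false, Bool.xor_true, Bool.not_true,
        Bool.not_false, if_true, if_false, Bool.false_eq_true]
      · rw [show (0 : ℚ) - (1 - q' z) = -(1 - q' z) by ring, abs_neg]
      · rw [show (1 : ℚ) - (1 - q' z) = -(0 - q' z) by ring, abs_neg]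
    have hr : ((univ.filter fun u : Fin m → Bool => K0 u = true ∧ X u ≠ s u).card : ℚ) =
        ((univ.filter fun u : Fin m → Bool => K0 u = true ∧ xor (X u) (A u) ≠ s' u).card : ℚ) := by
      congr 2; ext u
      simp only [mem_filter, mem_univ, true_and, hs']
      cases X u <;> cases A u <;> cases s u <;> simp
    rw [Finset.sum_congr rfl fun z _ => hl z, hr]
    exact h

/-- **ONE-WORD MI at `m = 8` from the single finite fact `OutHeavyEight`** (planner's chain with the repaired
Lemma G′: `relMIOfStar`, `oneWordOfRelMI`, `oneWordDecode`, `sc1At_of_isOpt1`). -/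
theorem oneWordMIEight_of_outHeavyEight (hO : OutHeavyEight) : OneWordMIEight := by
  intro K0 hK hsym
  obtain ⟨c, _, hc⟩ := hO K0 hK hsym
  exact oneWordOfRelMI 8 K0 (oneWordDecode 8)
    (relMIOfStar 8 K0 (starCert_of_outHeavyButOne (sc1At_of_isOpt1 hK) hc))

namespace MassInequality

/-- **LEMMA G′, repaired** (planner qa-qnc0-p1 Sketch14 ERRATUM 14:36Z, verbatim): with support concentration
at `K0`. -/
def StarOfOutHeavyButOneSC (m : ℕ) : Prop :=
  ∀ K0 c : (Fin m → Bool) → Bool, SC1At m K0 → OutHeavyButOne m K0 c → StarCert m K0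

/-- The repaired chain (Sketch14 ERRATUM, verbatim). -/
def OneWordMIEightChainSC : Prop :=
  OutHeavyEight → StarOfOutHeavyButOneSC 8 → RelMIOfStar 8 → OneWordOfRelMI 8 → OneWordDecode 8 → OneWordMIEight

/-- (Sketch14 ERRATUM, proof verbatim.) -/
theorem oneWordMIEightChainSC : OneWordMIEightChainSC := by
  intro hO hS hR hW hD K0 hK hsym
  obtain ⟨c, _, hc⟩ := hO K0 hK hsym
  exact hW K0 hD (hR K0 (hS K0 c (sc1At_of_isOpt1 hK) hc))

end MassInequality

/-- **`StarOfOutHeavyButOneSC m` for every `m` — PROVED** (= `starCert_of_outHeavyButOne`). -/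
theorem starOfOutHeavyButOneSC (m : ℕ) : MassInequality.StarOfOutHeavyButOneSC m :=
  fun _ _ hK hOH => starCert_of_outHeavyButOne hK hOH

end Summit.QuantumAdvantage.AdviceFreeQNC0
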